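import Literature.NumberTheory.EllipticCurves.GreenbergVatsal2000.ResidualSelmerGroups
import Literature.NumberTheory.EllipticCurves.Kobayashi2003.SignedSelmer
import Literature.NumberTheory.EllipticCurves.IwasawaSelmerProofs
import Literature.NumberTheory.EllipticCurves.KodairaNeronUnramifiedInertiaProofs
import Literature.NumberTheory.EllipticCurves.SelmerFiniteProofs
import Literature.NumberTheory.EllipticCurves.GeomPointsGaloisModule
import Summits.BirchSwinnertonDyer.BirchSwinnertonDyer.Theorems.ThetaPartnerAtTwoSignedTransportAtTwoResidualKummer
import Summits.BirchSwinnertonDyer.Rank1Residual.Additive.StrictSignedSelmerInftyLocal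
import HarnessLib

/-!
# Upper containment for the crux `SignedTransportAtTwo` (stmt-BirchSwinnertonDyer-20333, route `ThetaPartnerAtTwo`, line
# `bridge` v9, stub `stub_sel2U`), non-archimedean part: classes of Kobayashi's `Sel^ε(E/K_∞)` satisfy the signed Kummer
# condition over `K_∞` cut out by `⨆ₙ E^ε(K_n·K_v)`, and residual classes with Selmer Kummer image are UNRAMIFIED at
# every good place `v ∤ p`
# (lead prover bsd-wall-tp2-p1 g4; `--supports stmt-BirchSwinnertonDyer-20333`; route-independent, closes nothing)

HONEST FRAMING. THEOREMS ONLY (no definition); nothing about any curve is asserted; BSD is not proved by any of this.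
No import of any route file.

WHAT. Line `bridge` v9 splits the algebraic `μ`-stub of the crux along the Greenberg–Vatsal / B. D. Kim residual
devissage (GV Invent. Math. 142 (2000) p. 3 and Prop. (2.8); Kim, Asian J. Math. 13 (2009) Prop. 2.10; read at `p = 2`):
`Sel⁺(W/ℚ_∞)[2]` is compared with a residual Selmer-type group of `W[2]` cut out by TRANSPORTABLE local conditions. This
file proves two of the three containments of the registered stub `stub_sel2U`, for any number field `K`, any curve,
any prime `p`, any `ℤ_p`-extension `κ` and any `H ≤ Γ_K`:

* `§1` `conjH1_mem_localKummerOverOfEmb_iSup_of_mem_signedSelmerInfty` — every class of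
  `Sel^ε(E/K_∞) = ⨆ₙ res Sel^ε(E/K_n)` satisfies, at every `v ∣ p` and every conjugate, the Kummer condition over `K_∞`
  cut out by `⨆ₙ E^ε(K_n·K_v)` (restriction preserves Kummer conditions: the Additive cell's
  `Rank1Residual.Additive.resOfLe_mem_localKummerOverOfEmb`, reused);
* `§2` `mem_unramifiedKer_of_pushH1_mem_localKerOver` — a residual class `c ∈ H¹(H, E[p^∞][p])` whose Kummer image dies in
  `H¹(Gal(K̄_v/L_w), E(K̄_v))` at a good place `v ∤ p` is unramified at `v` (Silverman X.4.2: `p(τQ − Q) = 0 ⇒ τQ = Q` for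
  `τ` in the inertia group, tree `smul_localPoints_eq_of_mem_inertia_holds`; `I_v = res(absInertia K_v)`,
  `inertia_eq_absInertia`).

References: [Kobayashi2003] Def. 1.1; [GreenbergVatsal2000] p. 3, §2 p. 28, Prop. (2.8); [BDKim2009] Prop. 2.10;
[SilvermanAEC2009] X.§4 Thm. 4.2; [NeukirchANT1999] II (9.3), (9.6).
-/

set_option autoImplicit false
-- D-0017: single-problem summit, so `Summit.BirchSwinnertonDyer.BirchSwinnertonDyer.…` repeats a namespace BY DESIGN.
set_option linter.dupNamespace false

noncomputable section

open scoped Classical AddSubgroup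

open WeierstrassCurve NumberField IsDedekindDomain Literature Literature.NumberTheory.EllipticCurves
  Literature.NumberTheory.GaloisRepresentations Literature.NumberTheory.EllipticCurves.GreenbergVatsal2000
  Literature.NumberTheory.EllipticCurves.Kobayashi2003 ZpExtension

namespace Summit.BirchSwinnertonDyer.BirchSwinnertonDyer.Theorems.SignedTransportAtTwo

universe u

/-! ## §1. The signed Kummer condition over `K_∞` -/





section Tower

variable {K : Type u} [Field K] [NumberField K] (W : WeierstrassCurve K) {p : ℕ} [Fact p.Prime]
  (κ : ZpExtension K p)

/-- **Part (c) of the upper containment.** Every class of Kobayashi's `Sel^ε(E/K_∞) = ⨆ₙ res Sel^ε(E/K_n)` satisfies, at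
every place `v ∣ p` and every conjugate, the Kummer condition over `K_∞` cut out by the union `⨆ₙ E^ε(K_n·K_v)` of the
signed subgroups: a generator `res c`, `c ∈ Sel^ε(E/K_n)`, has `conj_σ (res c) = res (conj_σ c)`
(`resOfLe_comp_conjH1_holds`), `conj_σ c` satisfies the layer-`n` condition, restriction preserves Kummer conditions
(`resOfLe_mem_localKummerOverOfEmb`) and `E^ε(K_n·K_v) ≤ ⨆ₘ E^ε(K_m·K_v)`; the condition is additive.
[cite: Kobayashi2003, Def. 1.1] -/
theorem conjH1_mem_localKummerOverOfEmb_iSup_of_mem_signedSelmerInfty (ε : ℤˣ)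
    {s : W.subgroupH1 p κ.kerSubgroup} (hs : s ∈ signedSelmerInfty W κ ε)
    (v : HeightOneSpectrum (𝓞 K)) (hv : (p : 𝓞 K) ∈ v.asIdeal) (σ : Field.absoluteGaloisGroup K) :
    W.conjH1 p κ.kerSubgroup σ s ∈
      localKummerOverOfEmb W p κ.kerSubgroup (closureEmb (K := K) (v.adicCompletion K))
        (⨆ n : ℕ, signedLocalPoints κ (v.adicCompletion K) W ε n) := by
  revert σ
  refine AddSubgroup.iSup_induction (fun n => (signedSelmerLayer W κ ε n).map (W.layerToInfty κ n))
    (C := fun s => ∀ σ : Field.absoluteGaloisGroup K, W.conjH1 p κ.kerSubgroup σ s ∈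
      localKummerOverOfEmb W p κ.kerSubgroup (closureEmb (K := K) (v.adicCompletion K))
        (⨆ n : ℕ, signedLocalPoints κ (v.adicCompletion K) W ε n)) hs ?_ ?_ ?_
  · rintro n s ⟨c, hc, rfl⟩ σ
    have hcσ := ((mem_signedSelmerLayer_iff W κ ε n c).mp hc).2 v hv σ
    -- `conj_σ (res c) = res (conj_σ c)`
    have hcomm := congrArg (fun f ↦ f c)
      (resOfLe_comp_conjH1_holds (M := W.geomPrimaryTorsion p) (κ.kerSubgroup_le_layerSubgroup n) σ)
    simp only [AddMonoidHom.coe_comp, Function.comp_apply] at hcomm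
    change W.conjH1 p κ.kerSubgroup σ (W.resOfLe p (κ.kerSubgroup_le_layerSubgroup n) c) ∈ _
    change (Literature.NumberTheory.EllipticCurves.conjH1 κ.kerSubgroup (W.geomPrimaryTorsion p) σ)
      ((Literature.NumberTheory.EllipticCurves.resOfLe (W.geomPrimaryTorsion p)
        (κ.kerSubgroup_le_layerSubgroup n)) c) ∈ _
    rw [← hcomm]
    exact localKummerOverOfEmb_mono (le_iSup (fun m : ℕ => signedLocalPoints κ (v.adicCompletion K) W ε m) n)
      (Summit.BirchSwinnertonDyer.Rank1Residual.Additive.resOfLe_mem_localKummerOverOfEmb W p _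
        (κ.kerSubgroup_le_layerSubgroup n) _ hcσ)
  · intro σ
    rw [map_zero]
    exact zero_mem _
  · intro s t hs ht σ
    rw [map_add]
    exact add_mem (hs σ) (ht σ)

end Tower


/-! ## §2. Unramified away from `p` -/



variable {K : Type u} [Field K] [NumberField K] (W : WeierstrassCurve K) [W.IsElliptic] (p : ℕ)
  (H : Subgroup (Field.absoluteGaloisGroup K))

/-- **Residual classes with Selmer Kummer image are unramified at good `v ∤ p`.** Let `c ∈ H¹(H, E[p^∞][p])` (a residual
class over `L = K̄^H`) whose image `k(c) ∈ H¹(H, E[p^∞])` dies in `H¹(Gal(K̄_v/L_w), E(K̄_v))` at the place `w` of `L` cut out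
by the chosen embedding. Then `c` is unramified at `v`: a cocycle `φ` of `c` satisfies `ι φ(res τ) = τQ − Q` on
`Gal(K̄_v/L_w)` for some `Q ∈ E(K̄_v)`; for `τ` in the local inertia group `p(τQ − Q) = 0` forces `τQ = Q` at a good
place `v ∤ p` (Silverman X.4.2, tree `smul_localPoints_eq_of_mem_inertia_holds`), so `φ` vanishes on `H ⊓ I_v`
(`I_v = res(absInertia K_v)`, `inertia_eq_absInertia`). GV p. 3 / Kim Prop. 2.10 (`Sel[p]` inside the residual
Selmer group), the part away from `p`. [cite: GreenbergVatsal2000, p. 3 and §2 p. 28] [cite: SilvermanAEC2009, X.§4 Thm. 4.2] -/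
theorem mem_unramifiedKer_of_pushH1_mem_localKerOver {v : HeightOneSpectrum (𝓞 K)}
    (hv : W.HasGoodReductionAt v) (hpv : ((p : ℕ) : 𝓞 K) ∉ v.asIdeal)
    (c : subgroupH1 H ↥((↥(W.geomPrimaryTorsion p))[(p : ℤ)]))
    (hc : pushH1 H ((↥(W.geomPrimaryTorsion p))[(p : ℤ)]).subtype (subtype_torsionBy_smul W p) c ∈
      W.localKerOver p H (v.adicCompletion K)) :
    c ∈ GreenbergVatsal2000.unramifiedKer H ↥((↥(W.geomPrimaryTorsion p))[(p : ℤ)]) v := by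
  set ι := closureEmb (K := K) (v.adicCompletion K) with hι
  obtain ⟨φ, rfl⟩ := oneCocycleClass_surjective _ c
  -- unfold the local condition on `k(c)` to a point `Q`
  have hk : pushH1 H ((↥(W.geomPrimaryTorsion p))[(p : ℤ)]).subtype (subtype_torsionBy_smul W p)
      (oneCocycleClass _ φ) = oneCocycleClass (discreteTopRep H (W.geomPrimaryTorsion p))
        (contOneCocycles.pullback (ContinuousMonoidHom.id H)
          (resHomOfEquivariant (ContinuousMonoidHom.id H) ((↥(W.geomPrimaryTorsion p))[(p : ℤ)]).subtype
            (fun h x ↦ subtype_torsionBy_smul W p h x)) φ) :=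
    map_oneCocycleClass _ _ _ φ
  rw [hk, localKerOver, AddMonoidHom.mem_ker, localResOver, localResOverOfEmb] at hc
  erw [map_oneCocycleClass] at hc
  obtain ⟨Q, hQ⟩ := (oneCocycleClass_eq_zero_iff _ _).mp hc
  -- the value of `φ` at `res τ`, pushed to `E(K̄_v)`, is `τ Q − Q`
  have hval : ∀ τ : localSubgroupOfEmb H ι,
      pointsMapOfEmb W ι (((φ.1 (resGalSubgroupOfEmb H ι τ) : ↥((↥(W.geomPrimaryTorsion p))[(p : ℤ)])) :
        ↥(W.geomPrimaryTorsion p)) : W.geomPoints) = (τ : Field.absoluteGaloisGroup (v.adicCompletion K)) • Q - Q :=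
    fun τ ↦ hQ τ
  -- on the local inertia group the values vanish
  obtain ⟨𝔐, h𝔐⟩ := v.localPrimesAbove_nonempty
  obtain ⟨w, hw⟩ := v.exists_spectralValuation
  have hvan : ∀ τ : localSubgroupOfEmb H ι,
      (τ : Field.absoluteGaloisGroup (v.adicCompletion K)) ∈ absInertia (v.adicCompletion K) →
        φ.1 (resGalSubgroupOfEmb H ι τ) = 0 := by
    intro τ hτ
    have hτ' : (τ : Field.absoluteGaloisGroup (v.adicCompletion K)) ∈
        𝔐.inertia (Field.absoluteGaloisGroup (v.adicCompletion K)) := by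
      rwa [HeightOneSpectrum.inertia_eq_absInertia hw h𝔐]
    have hp0 : (p : ℤ) • ((τ : Field.absoluteGaloisGroup (v.adicCompletion K)) • Q - Q) = 0 := by
      rw [← hval τ, ← map_zsmul]
      have : (p : ℤ) • (φ.1 (resGalSubgroupOfEmb H ι τ) : ↥((↥(W.geomPrimaryTorsion p))[(p : ℤ)])) = 0 := by
        rw [natCast_zsmul]; exact AddSubgroup.torsionBy.nsmul _
      have h2 := congrArg (fun y : ↥((↥(W.geomPrimaryTorsion p))[(p : ℤ)]) ↦ ((y : ↥(W.geomPrimaryTorsion p)) : W.geomPoints)) this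
      simp only [AddSubgroupClass.coe_zsmul, ZeroMemClass.coe_zero] at h2
      rw [h2, map_zero]
    have hfix := W.smul_localPoints_eq_of_mem_inertia_holds v (fun h ↦ h hv) (n := (p : ℤ))
      (by rwa [Int.cast_natCast]) h𝔐 hτ' hp0
    have h0 : pointsMapOfEmb W ι (((φ.1 (resGalSubgroupOfEmb H ι τ) : ↥((↥(W.geomPrimaryTorsion p))[(p : ℤ)])) :
        ↥(W.geomPrimaryTorsion p)) : W.geomPoints) = 0 := by
      rw [hval τ, hfix, sub_self]
    have h1 := pointsMapOfEmb_injective W ι (h0.trans (map_zero _).symm)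
    exact Subtype.ext (Subtype.ext h1)
  -- conclude: `φ` vanishes on `H ⊓ I_v`
  change oneCocycleClass _ φ ∈ (resH1Hom (GreenbergSelmer.inertiaInToH H v) (AddMonoidHom.id _) _).ker
  rw [AddMonoidHom.mem_ker]
  erw [map_oneCocycleClass]
  refine (oneCocycleClass_eq_zero_iff _ _).mpr ⟨0, fun x ↦ ?_⟩
  rw [contOneCocycles.pullback_apply, map_zero, sub_zero]
  obtain ⟨hxH, hxI⟩ := (GreenbergSelmer.mem_inertiaIn_iff H v x.1).mp x.2
  obtain ⟨τ, hτI, hτx⟩ := Subgroup.mem_map.mp hxI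
  have hτH : τ ∈ localSubgroupOfEmb H ι := by
    rw [mem_localSubgroupOfEmb_iff]
    change (resGal (K := K) (v.adicCompletion K)) τ ∈ H
    rw [WeierstrassCurve.resGal_eq_absGaloisRestrict]
    change (absGaloisRestrict K (v.adicCompletion K)).toMonoidHom τ ∈ H
    rw [hτx]; exact hxH
  have e : GreenbergSelmer.inertiaInToH H v x = resGalSubgroupOfEmb H ι ⟨τ, hτH⟩ := by
    apply Subtype.ext
    change ((x : GreenbergSelmer.decomp (K := K) v) : Field.absoluteGaloisGroup K) = resGalOfEmb ι τ
    rw [← hτx]; rfl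
  change (resHomOfEquivariant _ _ _).hom (φ.1 (GreenbergSelmer.inertiaInToH H v x)) = 0
  rw [e, hvan ⟨τ, hτH⟩ hτI, map_zero]


end Summit.BirchSwinnertonDyer.BirchSwinnertonDyer.Theorems.SignedTransportAtTwo

end
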